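import Literature.NumberTheory.EllipticCurves.ModularCurveCoordinateFunctions
import Literature.NumberTheory.EllipticCurves.KleinJIntegralQExpansion
import Literature.NumberTheory.EllipticCurves.ModularCurveSturmProofs
import HarnessLib

/-!
# The coordinate functions of `X₀(N)` have rational `q`-expansions: `σ ∈ Aut(ℂ)` fixes them

Topic `NumberTheory/EllipticCurves` ("canonical model of `X₀(N)` at CM points" chain).  A field
endomorphism `σ` of `ℂ` acts on Laurent `q`-series coefficientwise (`mapLaurent σ`).  The eight
coordinate forms `coordForm N i` (`E₄³, E₆², E₄²E₄(Nτ), E₆E₆(Nτ), E₄(Nτ)³, E₆(Nτ)², E₄E₄(Nτ)²,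
E₄³`) and `Δ` have `q`-expansions with **rational coefficients** — Mathlib's
`EisensteinSeries.E_qExpansion_coeff` (`E_k = 1 − (2k/B_k) Σ σ_{k−1}(n)qⁿ`), the tree's
`qExpansion_discriminant` (`Δ = q∏(1 − qⁿ)²⁴ ∈ ℤ⟦q⟧`), the substitution `q ↦ q^N` for `f(Nτ)`
(`coeff_qExpansion_scaleN`), and multiplicativity of `q`-expansions — so `σ` fixes them
(`map_qExpansion_coordForm`, `map_qExpansion_deltaN`).  Consequently **`σ` fixes the coordinate
functions `vᵢ = coordForm N i/Δ ∈ K_N ⊆ ℂ((q))`** (`mapLaurent_coordFn`) and acts on the coordinate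
algebra through the coefficients of polynomials: `σ(p(v)) = p^σ(v)` (`mapLaurent_aeval`).  This is
the (elementary, Eisenstein-series) rational structure on `ℂ(X₀(N))` used to transport values of
modular functions at CM points along `Aut(ℂ)` (Shimura 1971, §6.1–6.2 and Prop. 6.9, there via the
`q`-expansion principle; Diamond–Shurman §1.2, §7.5).

Everything is proved; no named facts are introduced (`IsRatQExp σ φ` is an auxiliary predicate).

## References

* G. Shimura, *Introduction to the arithmetic theory of automorphic functions*, 1971, §6.1–6.2.
  [ShimuraIATAF1971]
* F. Diamond, J. Shurman, *A First Course in Modular Forms*, GTM 228, 2005, §1.1–1.2.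
  [DiamondShurman2005]
-/

noncomputable section

open scoped MatrixGroups ModularForm Modular Classical IntermediateField
open CongruenceSubgroup Matrix.SpecialLinearGroup ModularGroup ModularForm EisensteinSeries Complex
  Function PowerSeries
open UpperHalfPlane hiding I

namespace Literature.NumberTheory.EllipticCurves.ModularForms

variable {N : ℕ} [NeZero N]

/-! ### `σ` acting coefficientwise on Laurent series -/

/-- **The coefficientwise action of a ring endomorphism `σ` of `ℂ` on `ℂ((q))`.** [folklore] -/
def mapLaurent (σ : ℂ →+* ℂ) : LaurentSeries ℂ →+* LaurentSeries ℂ where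
  toFun x := x.map σ
  map_one' := HahnSeries.map_one σ.toMonoidWithZeroHom
  map_mul' _ _ := HahnSeries.map_mul σ.toNonUnitalRingHom
  map_zero' := HahnSeries.map_zero σ.toMonoidWithZeroHom.toZeroHom
  map_add' _ _ := HahnSeries.map_add σ.toAddMonoidHom

/-- Coefficients of `mapLaurent σ x`. [folklore] -/
@[simp] theorem coeff_mapLaurent (σ : ℂ →+* ℂ) (x : LaurentSeries ℂ) (i : ℤ) :
    (mapLaurent σ x).coeff i = σ (x.coeff i) := rfl

/-- `mapLaurent σ` restricted to power series is `PowerSeries.map σ`. [folklore] -/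
theorem mapLaurent_coe_powerSeries (σ : ℂ →+* ℂ) (p : ℂ⟦X⟧) :
    mapLaurent σ (p : LaurentSeries ℂ) = ((p.map σ : ℂ⟦X⟧) : LaurentSeries ℂ) := by
  ext i
  rw [coeff_mapLaurent, PowerSeries.coeff_coe, PowerSeries.coeff_coe]
  split_ifs with h
  · exact map_zero σ
  · rw [coeff_map]

/-- `mapLaurent σ` on constants. [folklore] -/
theorem mapLaurent_algebraMap (σ : ℂ →+* ℂ) (c : ℂ) :
    mapLaurent σ (algebraMap ℂ (LaurentSeries ℂ) c) = algebraMap ℂ (LaurentSeries ℂ) (σ c) := by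
  rw [algebraMap_laurentSeries_apply, algebraMap_laurentSeries_apply]
  exact HahnSeries.map_C c σ

/-! ### Functions with `σ`-invariant `q`-expansion -/

/-- `IsRatQExp σ φ`: the cusp function of `φ : ℍ → ℂ` (period `1`) is analytic at `q = 0` and its
`q`-expansion is fixed coefficientwise by `σ` (e.g. has rational coefficients). [folklore] -/
structure IsRatQExp (σ : ℂ →+* ℂ) (φ : ℍ → ℂ) : Prop where
  analyticAt : AnalyticAt ℂ (cuspFunction 1 φ) 0
  map_eq : (qExpansion 1 φ).map σ = qExpansion 1 φ

namespace IsRatQExp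

variable {σ : ℂ →+* ℂ} {φ ψ : ℍ → ℂ}

/-- Products. [folklore] -/
theorem mul (hφ : IsRatQExp σ φ) (hψ : IsRatQExp σ ψ) : IsRatQExp σ (φ * ψ) where
  analyticAt := by
    rw [UpperHalfPlane.cuspFunction_mul hφ.analyticAt.continuousAt hψ.analyticAt.continuousAt]
    exact hφ.analyticAt.mul hψ.analyticAt
  map_eq := by
    rw [UpperHalfPlane.qExpansion_mul hφ.analyticAt hψ.analyticAt, map_mul, hφ.map_eq, hψ.map_eq]

/-- Squares. [folklore] -/
theorem pow_two (hφ : IsRatQExp σ φ) : IsRatQExp σ (φ ^ 2) := by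
  rw [_root_.pow_two]; exact hφ.mul hφ

/-- Cubes. [folklore] -/
theorem pow_three (hφ : IsRatQExp σ φ) : IsRatQExp σ (φ ^ 3) := by
  rw [_root_.pow_three]; exact hφ.mul (hφ.mul hφ)

end IsRatQExp

/-! ### The Eisenstein series, `Δ`, and their `N`-scalings -/

section Base

variable (σ : ℂ →+* ℂ)

omit [NeZero N] in
/-- The normalised Eisenstein series `E_k` have rational `q`-expansions. [folklore] -/
theorem isRatQExp_E {k : ℕ} (hk : 3 ≤ k) (hk2 : Even k) : IsRatQExp σ ⇑(E hk) where
  analyticAt := ModularFormClass.analyticAt_cuspFunction_zero (E hk) one_pos one_mem_strictPeriods_SL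
  map_eq := by
    ext m
    rw [coeff_map, EisensteinSeries.E_qExpansion_coeff hk hk2 m]
    split_ifs with hm
    · exact map_one σ
    · rw [map_mul, map_neg, map_div₀, map_mul, map_natCast, map_ofNat, map_ratCast, map_natCast]

omit [NeZero N] in
/-- `E₄` has a rational `q`-expansion. [folklore] -/
theorem isRatQExp_E₄ : IsRatQExp σ ⇑ModularForm.E₄ := isRatQExp_E σ (by norm_num) (by decide)

omit [NeZero N] in
/-- `E₆` has a rational `q`-expansion. [folklore] -/
theorem isRatQExp_E₆ : IsRatQExp σ ⇑ModularForm.E₆ := isRatQExp_E σ (by norm_num) (by decide)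

omit [NeZero N] in
/-- `Δ` has an integral `q`-expansion. [folklore] -/
theorem isRatQExp_discriminant : IsRatQExp σ ⇑CuspForm.discriminant where
  analyticAt := ModularFormClass.analyticAt_cuspFunction_zero CuspForm.discriminant one_pos one_mem_strictPeriods_SL
  map_eq := by
    have hσ : σ.comp (Int.castRingHom ℂ) = Int.castRingHom ℂ := RingHom.ext_int _ _
    rw [CuspForm.coe_discriminant, qExpansion_discriminant]
    conv_rhs => rw [← hσ, PowerSeries.map_comp]
    rfl

/-- **`q`-expansion of `f(Nτ)`**: `aₘ(V_N f) = a_{m/N}(f)` if `N ∣ m`, else `0`. [folklore] -/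
theorem coeff_qExpansion_scaleN {k : ℤ} (f : ModularForm 𝒮ℒ k) (m : ℕ) :
    coeff m (qExpansion 1 ⇑(scaleN N f)) =
      if N ∣ m then coeff (m / N) (qExpansion 1 ⇑f) else 0 := by
  set c : ℕ → ℂ := fun n ↦ coeff n (qExpansion 1 ⇑f) with hc
  set c' : ℕ → ℂ := fun m ↦ if N ∣ m then c (m / N) else 0 with hc'
  have hN : N ≠ 0 := NeZero.ne N
  have hper : Periodic (⇑f ∘ ofComplex) 1 := by
    simpa using SlashInvariantFormClass.periodic_comp_ofComplex (h := 1) f one_mem_strictPeriods_SL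
  have hf : ∀ τ : ℍ, HasSum (fun n ↦ c n • Periodic.qParam 1 τ ^ n) (f τ) := fun τ ↦
    hasSum_qExpansion one_pos hper f.holo' (ModularFormClass.bdd_at_infty f) τ
  -- the `q`-series of `V_N f`
  have hsum : ∀ τ : ℍ, HasSum (fun m ↦ c' m • Periodic.qParam 1 τ ^ m) (scaleN N f τ) := by
    intro τ
    have hq : Periodic.qParam 1 ((tpD N • τ : ℍ) : ℂ) = Periodic.qParam 1 (τ : ℂ) ^ N := by
      rw [← levelPoint_eq_tpD_smul, coe_levelPoint]
      simp only [Periodic.qParam, ofReal_one, div_one]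
      rw [← Complex.exp_nat_mul]
      congr 1; ring
    have h1 : HasSum (fun n ↦ c n • (Periodic.qParam 1 τ ^ N) ^ n) (scaleN N f τ) := by
      rw [scaleN_apply, ← hq]; exact hf _
    have hinj : Injective fun n : ℕ ↦ N * n := mul_right_injective₀ hN
    have h2 : (fun m ↦ c' m • Periodic.qParam 1 τ ^ m) ∘ (fun n : ℕ ↦ N * n) =
        fun n ↦ c n • (Periodic.qParam 1 τ ^ N) ^ n := by
      funext n
      simp only [comp_apply, hc', if_pos (dvd_mul_right N n), Nat.mul_div_cancel_left n (Nat.pos_of_ne_zero hN),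
        pow_mul]
    rw [← h2] at h1
    refine (hinj.hasSum_iff ?_).mp h1
    intro m hm
    have hndvd : ¬ N ∣ m := fun ⟨n, hn⟩ ↦ hm ⟨n, hn.symm⟩
    simp [hc', hndvd]
  have := ModularFormClass.qExpansion_coeff_unique one_pos (one_mem_strictPeriods_coe_gamma0 N)
    (f := scaleN N f) hsum m
  rw [← this]

/-- `V_N f` has a `σ`-fixed `q`-expansion if `f` has. [folklore] -/
theorem isRatQExp_scaleN {k : ℤ} (f : ModularForm 𝒮ℒ k) (hf : (qExpansion 1 ⇑f).map σ = qExpansion 1 ⇑f) :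
    IsRatQExp σ ⇑(scaleN N f) where
  analyticAt := ModularFormClass.analyticAt_cuspFunction_zero (scaleN N f) one_pos
    (one_mem_strictPeriods_coe_gamma0 N)
  map_eq := by
    ext m
    rw [coeff_map, coeff_qExpansion_scaleN]
    split_ifs with h
    · have := congrArg (coeff (m / N)) hf
      rwa [coeff_map] at this
    · exact map_zero σ

/-- `E₄(Nτ)` has a rational `q`-expansion. [folklore] -/
theorem isRatQExp_scaleN_E₄ : IsRatQExp σ ⇑(scaleN N ModularForm.E₄) :=
  isRatQExp_scaleN σ _ (isRatQExp_E₄ σ).map_eq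

/-- `E₆(Nτ)` has a rational `q`-expansion. [folklore] -/
theorem isRatQExp_scaleN_E₆ : IsRatQExp σ ⇑(scaleN N ModularForm.E₆) :=
  isRatQExp_scaleN σ _ (isRatQExp_E₆ σ).map_eq

/-! ### The eight coordinate forms and `Δ` -/

omit [NeZero N] in
/-- `Δ|_{Γ₀(N)}` has an integral `q`-expansion. [folklore] -/
theorem isRatQExp_deltaN : IsRatQExp σ ⇑(deltaN N) :=
  isRatQExp_discriminant σ

/-- The coordinate forms as functions: products of `E₄, E₆, E₄(Nτ), E₆(Nτ)`. [folklore] -/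
theorem coe_coordForm (i : Fin 8) :
    (⇑(coordForm N i) : ℍ → ℂ) =
      match i with
      | 0 => (⇑ModularForm.E₄) ^ 3
      | 1 => (⇑ModularForm.E₆) ^ 2
      | 2 => (⇑ModularForm.E₄) ^ 2 * ⇑(scaleN N ModularForm.E₄)
      | 3 => ⇑ModularForm.E₆ * ⇑(scaleN N ModularForm.E₆)
      | 4 => ⇑(scaleN N ModularForm.E₄) ^ 3
      | 5 => ⇑(scaleN N ModularForm.E₆) ^ 2
      | 6 => ⇑ModularForm.E₄ * (⇑(scaleN N ModularForm.E₄) * ⇑(scaleN N ModularForm.E₄))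
      | 7 => (⇑ModularForm.E₄) ^ 3 := by
  fin_cases i
  · funext τ; simp [coordForm, eisMonomial_apply]
  · funext τ; simp [coordForm, eisMonomial_apply]
  · funext τ; simp [coordForm, eisMonomial_apply]
  · funext τ; simp [coordForm, eisMonomial_apply]
  · funext τ; simp [coordForm, eisMonomial_apply]
  · funext τ; simp [coordForm, eisMonomial_apply]
  · funext τ; rfl
  · funext τ; simp [coordForm, coe_ofLevelOne]

/-- **The coordinate forms have rational `q`-expansions.** [folklore] -/
theorem isRatQExp_coordForm (i : Fin 8) : IsRatQExp σ ⇑(coordForm N i) := by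
  have h4 := isRatQExp_E₄ σ
  have h6 := isRatQExp_E₆ σ
  have hV4 := isRatQExp_scaleN_E₄ (N := N) σ
  have hV6 := isRatQExp_scaleN_E₆ (N := N) σ
  rw [coe_coordForm]
  fin_cases i
  · exact h4.pow_three
  · exact h6.pow_two
  · exact h4.pow_two.mul hV4
  · exact h6.mul hV6
  · exact hV4.pow_three
  · exact hV6.pow_two
  · exact h4.mul (hV4.mul hV4)
  · exact h4.pow_three

/-- `σ` fixes the `q`-expansion of every coordinate form. [folklore] -/
theorem map_qExpansion_coordForm (i : Fin 8) :
    (qExpansion 1 ⇑(coordForm N i)).map σ = qExpansion 1 ⇑(coordForm N i) :=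
  (isRatQExp_coordForm σ i).map_eq

omit [NeZero N] in
/-- `σ` fixes the `q`-expansion of `Δ`. [folklore] -/
theorem map_qExpansion_deltaN : (qExpansion 1 ⇑(deltaN N)).map σ = qExpansion 1 ⇑(deltaN N) :=
  (isRatQExp_deltaN (N := N) σ).map_eq

/-! ### `σ` fixes the coordinate functions and acts on the coordinate algebra -/

/-- **`σ` fixes the coordinate functions `vᵢ ∈ K_N ⊆ ℂ((q))`.** [folklore] -/
theorem mapLaurent_coordFn (i : Fin 8) :
    mapLaurent σ ((coordFn N i : modularFunctionField N) : LaurentSeries ℂ) = coordFn N i := by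
  change mapLaurent σ (qExpansionL N (coordForm N i) / qExpansionL N (deltaN N)) =
    qExpansionL N (coordForm N i) / qExpansionL N (deltaN N)
  rw [map_div₀, qExpansionL_def, qExpansionL_def, mapLaurent_coe_powerSeries, mapLaurent_coe_powerSeries,
    map_qExpansion_coordForm, map_qExpansion_deltaN]

/-- **`σ` acts on the coordinate algebra through the coefficients**: `σ(p(v)) = p^σ(v)` for every
coordinate polynomial `p`. [folklore] -/
theorem mapLaurent_aeval (p : MvPolynomial (Fin 8) ℂ) :
    mapLaurent σ ((MvPolynomial.aeval (coordFn N) p : modularFunctionField N) : LaurentSeries ℂ) =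
      ((MvPolynomial.aeval (coordFn N) (MvPolynomial.map σ p) : modularFunctionField N) : LaurentSeries ℂ) := by
  set ι : modularFunctionField N →+* LaurentSeries ℂ := (modularFunctionField N).toSubfield.subtype with hι
  have hιapp : ∀ x : modularFunctionField N, ι x = (x : LaurentSeries ℂ) := fun x ↦ rfl
  set φ₁ : MvPolynomial (Fin 8) ℂ →+* LaurentSeries ℂ :=
    (mapLaurent σ).comp (ι.comp (MvPolynomial.aeval (coordFn N)).toRingHom) with hφ₁
  set φ₂ : MvPolynomial (Fin 8) ℂ →+* LaurentSeries ℂ :=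
    (ι.comp (MvPolynomial.aeval (coordFn N)).toRingHom).comp (MvPolynomial.map σ) with hφ₂
  have heq : φ₁ = φ₂ := by
    refine MvPolynomial.ringHom_ext (fun a ↦ ?_) (fun i ↦ ?_)
    · simp only [hφ₁, hφ₂, RingHom.coe_comp, comp_apply, AlgHom.toRingHom_eq_coe, AlgHom.coe_toRingHom,
        MvPolynomial.map_C, MvPolynomial.aeval_C, hιapp]
      rw [show ((algebraMap ℂ (modularFunctionField N) a : modularFunctionField N) : LaurentSeries ℂ) =
          algebraMap ℂ (LaurentSeries ℂ) a from rfl, mapLaurent_algebraMap]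
      rfl
    · simp only [hφ₁, hφ₂, RingHom.coe_comp, comp_apply, AlgHom.toRingHom_eq_coe, AlgHom.coe_toRingHom,
        MvPolynomial.map_X, MvPolynomial.aeval_X, hιapp]
      exact mapLaurent_coordFn σ i
  have := congrArg (fun ψ : MvPolynomial (Fin 8) ℂ →+* LaurentSeries ℂ ↦ ψ p) heq
  simpa [hφ₁, hφ₂, hιapp] using this

end Base

end Literature.NumberTheory.EllipticCurves.ModularForms

end
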